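import Summits.RiemannHypothesis.RiemannHypothesis.Theorems.IntegerScrewCensusDualWalk

/-!
# Route `IntegerScrew` — kernel checker for the census DUAL certificates (3): the polynomial layer

Semantics of the coefficient-list operations of `IntegerScrewCensusDualWalk`: evaluation `evalZ`, the change of variable
`tauPoly` (`H(τ) = P(2τ−1)`), the formal derivative `derivZ` (with `HasDerivAt`, hence the chain rule through `tauPoly`),
`padTo`, the nonnegative shifted Horner form (`negFloor`, `prepGo`, `hornerR`, `geoSum`:
`hornerR m (prepGo C D 0 H) − C·geoSum D m = Σ_k H_k m^k M^{D−k} = M^D·H(m/M)`), and the ABSTRACT soundness of the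
adaptive walk `walkGo`: if a real function `g` with companions `g₁, g₂` satisfies the one-sided third-order Taylor
inequality `g(τ+u) ≥ g(τ) + g₁(τ)u + ½g₂(τ)u² − Λu³` (`0 ≤ u ≤ 1/16`) and the three Horner values bound `K·g, K·g₁, K·g₂`
from below at the dyadic points up to the slacks, then `walkGo … = true` gives `g ≥ 0` on the walked interval.
Pure algebra/analysis of lists and polynomials; RH-free; nothing here bears on the truth of RH.
-/

set_option linter.dupNamespace false
set_option autoImplicit false

namespace Summit.RiemannHypothesis.RiemannHypothesis.Theorems.IntegerScrew.Manifest.Fast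

open Finset

/-! ### Evaluation of coefficient lists -/

/-- `Σ_k c_k x^k` for a coefficient list (low degree first). -/
noncomputable def evalZ : List ℤ → ℝ → ℝ
  | [], _ => 0
  | c :: cs, x => (c : ℝ) + x * evalZ cs x

/-- `evalZ [] x = 0`. -/
@[simp] theorem evalZ_nil (x : ℝ) : evalZ [] x = 0 := rfl

/-- `evalZ (c :: cs) x = c + x · evalZ cs x`. -/
@[simp] theorem evalZ_cons (c : ℤ) (cs : List ℤ) (x : ℝ) : evalZ (c :: cs) x = (c : ℝ) + x * evalZ cs x := rfl

/-- `evalZ` as a finite sum. -/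
theorem evalZ_eq_sum : ∀ (cs : List ℤ) (x : ℝ), evalZ cs x = ∑ k ∈ range cs.length, ((cs.getD k 0 : ℤ) : ℝ) * x ^ k
  | [], x => by simp
  | c :: cs, x => by
    rw [evalZ_cons, evalZ_eq_sum cs x, List.length_cons, Finset.sum_range_succ', Finset.mul_sum]
    simp only [List.getD_cons_succ, List.getD_cons_zero, pow_zero, mul_one, pow_succ]
    rw [add_comm]
    congr 1
    exact Finset.sum_congr rfl fun k _ => by ring

/-- `evalZ` is additive under `addZ`. -/
theorem evalZ_addZ : ∀ (p q : List ℤ) (x : ℝ), evalZ (addZ p q) x = evalZ p x + evalZ q x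
  | [], q, x => by simp [addZ]
  | p :: ps, [], x => by simp [addZ]
  | p :: ps, q :: qs, x => by
    simp only [addZ, evalZ_cons, evalZ_addZ ps qs x, Int.cast_add]
    ring

/-- `evalZ (mulLinTail (p₀ :: ps)) x = 2p₀ + (2x − 1)·evalZ ps x`. -/
theorem evalZ_mulLinTail : ∀ (p0 : ℤ) (ps : List ℤ) (x : ℝ),
    evalZ (mulLinTail (p0 :: ps)) x = 2 * (p0 : ℝ) + (2 * x - 1) * evalZ ps x
  | p0, [], x => by simp [mulLinTail]
  | p0, p1 :: ps, x => by
    have ih := evalZ_mulLinTail p1 ps x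
    simp only [mulLinTail] at ih ⊢
    rw [evalZ_cons, ih, evalZ_cons]
    push_cast
    ring

/-- `evalZ (mulLinAdd g p) x = g + (2x − 1)·evalZ p x`. -/
theorem evalZ_mulLinAdd (g : ℤ) : ∀ (p : List ℤ) (x : ℝ), evalZ (mulLinAdd g p) x = (g : ℝ) + (2 * x - 1) * evalZ p x
  | [], x => by simp [mulLinAdd]
  | p0 :: ps, x => by
    simp only [mulLinAdd]
    rw [evalZ_cons, evalZ_mulLinTail, evalZ_cons]
    push_cast
    ring

/-- `tauPoly` on `cons`. -/
theorem tauPoly_cons (g : ℤ) (gs : List ℤ) : tauPoly (g :: gs) = mulLinAdd g (tauPoly gs) := rfl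

/-- **`H(τ) = P(2τ − 1)`.** -/
theorem evalZ_tauPoly : ∀ (gs : List ℤ) (τ : ℝ), evalZ (tauPoly gs) τ = evalZ gs (2 * τ - 1)
  | [], τ => by simp [tauPoly]
  | g :: gs, τ => by rw [tauPoly_cons, evalZ_mulLinAdd, evalZ_tauPoly gs τ, evalZ_cons]

/-! ### Lengths -/

/-- `mulLinTail` preserves length. -/
theorem length_mulLinTail : ∀ (p : List ℤ), (mulLinTail p).length = p.length
  | [] => rfl
  | [x] => rfl
  | x :: y :: rest => by simp only [mulLinTail, List.length_cons, length_mulLinTail (y :: rest)]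

/-- `mulLinAdd` adds one coefficient. -/
theorem length_mulLinAdd (g : ℤ) : ∀ (p : List ℤ), (mulLinAdd g p).length = p.length + 1
  | [] => rfl
  | p0 :: ps => by simp only [mulLinAdd, List.length_cons, length_mulLinTail]

/-- `tauPoly` preserves length. -/
theorem length_tauPoly : ∀ (gs : List ℤ), (tauPoly gs).length = gs.length
  | [] => rfl
  | g :: gs => by rw [tauPoly_cons, length_mulLinAdd, length_tauPoly gs, List.length_cons]

/-- `addZ` has the longer length. -/
theorem length_addZ : ∀ (p q : List ℤ), (addZ p q).length = max p.length q.length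
  | [], q => by simp [addZ]
  | p :: ps, [] => by simp [addZ]
  | p :: ps, q :: qs => by simp [addZ, length_addZ ps qs, Nat.succ_max_succ]

/-- `derivZ` does not lengthen. -/
theorem length_derivZ : ∀ (cs : List ℤ), (derivZ cs).length ≤ cs.length
  | [] => by simp [derivZ]
  | c :: cs => by
    simp only [derivZ, length_addZ, List.length_cons]
    have := length_derivZ cs
    omega

/-- `padTo D` has length `D + 1`. -/
theorem length_padTo (D : ℕ) (cs : List ℤ) : (padTo D cs).length = D + 1 := by simp [padTo]

/-- `gList D …` has length `D + 1`. -/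
theorem length_gList (D H : ℕ) (acc : CellAcc) (c : ℤ) : (gList D H acc c).length = D + 1 := by
  simp [gList]

/-- `padTo` does not change the value when it only pads. -/
theorem evalZ_padTo {D : ℕ} {cs : List ℤ} (h : cs.length ≤ D + 1) (x : ℝ) : evalZ (padTo D cs) x = evalZ cs x := by
  rw [evalZ_eq_sum, evalZ_eq_sum, length_padTo]
  have hsplit := Finset.sum_range_add_sum_Ico (fun k => ((cs.getD k 0 : ℤ) : ℝ) * x ^ k) h
  have hz : ∑ k ∈ Finset.Ico cs.length (D + 1), ((cs.getD k 0 : ℤ) : ℝ) * x ^ k = 0 := by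
    refine Finset.sum_eq_zero fun k hk => ?_
    rw [Finset.mem_Ico] at hk
    rw [List.getD_eq_default _ _ hk.1]
    simp
  rw [hz, add_zero] at hsplit
  rw [hsplit]
  refine Finset.sum_congr rfl fun k hk => ?_
  rw [Finset.mem_range] at hk
  unfold padTo
  rw [List.getD_eq_getElem _ _ (by simpa using hk)]
  simp

/-! ### The formal derivative -/

/-- `evalZ (0 :: q) x = x · evalZ q x`. -/
theorem evalZ_zero_cons (q : List ℤ) (x : ℝ) : evalZ (0 :: q) x = x * evalZ q x := by simp

/-- `(c + x p)′ = p + x p′` at the level of `evalZ`. -/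
theorem evalZ_derivZ_cons (c : ℤ) (cs : List ℤ) (x : ℝ) :
    evalZ (derivZ (c :: cs)) x = evalZ cs x + x * evalZ (derivZ cs) x := by
  show evalZ (addZ cs (0 :: derivZ cs)) x = _
  rw [evalZ_addZ, evalZ_zero_cons]

/-- **The formal derivative is the derivative.** -/
theorem hasDerivAt_evalZ : ∀ (cs : List ℤ) (x : ℝ), HasDerivAt (fun y => evalZ cs y) (evalZ (derivZ cs) x) x
  | [], x => by simpa [derivZ] using hasDerivAt_const x (0 : ℝ)
  | c :: cs, x => by
    have ih := hasDerivAt_evalZ cs x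
    have h1 : HasDerivAt (fun y => y * evalZ cs y) (1 * evalZ cs x + x * evalZ (derivZ cs) x) x :=
      (hasDerivAt_id x).mul ih
    have h2 := h1.const_add (c : ℝ)
    rw [evalZ_derivZ_cons]
    simpa using h2

/-- Chain rule through `tauPoly`: `H′(τ) = 2·P′(2τ − 1)`. -/
theorem evalZ_derivZ_tauPoly (gs : List ℤ) (τ : ℝ) :
    evalZ (derivZ (tauPoly gs)) τ = 2 * evalZ (derivZ gs) (2 * τ - 1) := by
  have h1 : HasDerivAt (fun y => evalZ (tauPoly gs) y) (evalZ (derivZ (tauPoly gs)) τ) τ := hasDerivAt_evalZ _ _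
  have h2 : HasDerivAt (fun y => evalZ gs (2 * y - 1)) (evalZ (derivZ gs) (2 * τ - 1) * 2) τ := by
    have ha : HasDerivAt (fun y : ℝ => 2 * y - 1) 2 τ := by
      simpa using ((hasDerivAt_id τ).const_mul (2 : ℝ)).sub_const (1 : ℝ)
    exact (hasDerivAt_evalZ gs (2 * τ - 1)).comp τ ha
  have h3 : (fun y => evalZ (tauPoly gs) y) = fun y => evalZ gs (2 * y - 1) := by
    funext y; exact evalZ_tauPoly gs y
  rw [h3] at h1
  have := h1.unique h2
  rw [this, mul_comm]

/-- Second derivative through `tauPoly`: `H″(τ) = 4·P″(2τ − 1)`. -/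
theorem evalZ_derivZ2_tauPoly (gs : List ℤ) (τ : ℝ) :
    evalZ (derivZ (derivZ (tauPoly gs))) τ = 4 * evalZ (derivZ (derivZ gs)) (2 * τ - 1) := by
  have h1 : HasDerivAt (fun y => evalZ (derivZ (tauPoly gs)) y) (evalZ (derivZ (derivZ (tauPoly gs))) τ) τ :=
    hasDerivAt_evalZ _ _
  have h2 : HasDerivAt (fun y => 2 * evalZ (derivZ gs) (2 * y - 1)) (2 * (evalZ (derivZ (derivZ gs)) (2 * τ - 1) * 2)) τ := by
    have ha : HasDerivAt (fun y : ℝ => 2 * y - 1) 2 τ := by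
      simpa using ((hasDerivAt_id τ).const_mul (2 : ℝ)).sub_const (1 : ℝ)
    exact ((hasDerivAt_evalZ (derivZ gs) (2 * τ - 1)).comp τ ha).const_mul 2
  have h3 : (fun y => evalZ (derivZ (tauPoly gs)) y) = fun y => 2 * evalZ (derivZ gs) (2 * y - 1) := by
    funext y; exact evalZ_derivZ_tauPoly gs y
  rw [h3] at h1
  have := h1.unique h2
  rw [this]; ring

/-! ### The nonnegative Horner form -/

/-- `negFloor` makes every coefficient nonnegative. -/
theorem negFloor_spec : ∀ (cs : List ℤ), ∀ c ∈ cs, 0 ≤ c + negFloor cs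
  | [], c, h => by simp at h
  | c0 :: cs, c, h => by
    simp only [negFloor, List.mem_cons] at h ⊢
    rcases h with rfl | h
    · have : -c ≤ ((-c).toNat : ℤ) := Int.self_le_toNat (-c)
      push_cast [Nat.cast_max]
      have hm : (((-c).toNat : ℕ) : ℤ) ≤ max (((-c).toNat : ℕ) : ℤ) (negFloor cs) := le_max_left _ _
      linarith
    · have ih := negFloor_spec cs c h
      push_cast [Nat.cast_max]
      have hm : ((negFloor cs : ℕ) : ℤ) ≤ max (((-c0).toNat : ℕ) : ℤ) (negFloor cs) := le_max_right _ _
      linarith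

/-- `hornerR` is the polynomial value `Σ_k c_k m^k`. -/
theorem hornerR_eq_sum (m : ℕ) : ∀ (cs : List ℕ), hornerR m cs = ∑ k ∈ range cs.length, cs.getD k 0 * m ^ k
  | [] => by simp [hornerR]
  | c :: cs => by
    show Nat.add c (Nat.mul m (hornerR m cs)) = _
    rw [Nat.add_eq, Nat.mul_eq, hornerR_eq_sum m cs, List.length_cons, Finset.sum_range_succ', Finset.mul_sum]
    simp only [List.getD_cons_succ, List.getD_cons_zero, pow_zero, mul_one, pow_succ]
    rw [add_comm]
    congr 1
    exact Finset.sum_congr rfl fun k _ => by ring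

/-- Length of `prepGo`. -/
theorem length_prepGo (C D : ℕ) : ∀ (k : ℕ) (cs : List ℤ), (prepGo C D k cs).length = cs.length
  | _, [] => rfl
  | k, c :: cs => by simp only [prepGo, List.length_cons, length_prepGo C D (k + 1) cs]

/-- Entries of `prepGo`: `(c_i + C)·2^{R(D − (k+i))}`. -/
theorem getD_prepGo (C D : ℕ) : ∀ (k : ℕ) (cs : List ℤ) (i : ℕ), i < cs.length →
    (prepGo C D k cs).getD i 0 = (cs.getD i 0 + C).toNat * 2 ^ (RB * (D - (k + i)))
  | _, [], i, h => by simp at h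
  | k, c :: cs, 0, _ => by simp [prepGo, Nat.shiftLeft_eq]
  | k, c :: cs, i + 1, h => by
    simp only [prepGo, List.getD_cons_succ]
    rw [getD_prepGo C D (k + 1) cs i (by simpa using h), show k + 1 + i = k + (i + 1) by omega]

/-- **The shifted Horner value**: with all `c_k + C ≥ 0` and `cs` of length `D + 1`,
`hornerR m (prepGo C D 0 cs) = Σ_{k ≤ D} (c_k + C) m^k M^{D−k}` (in `ℤ`). -/
theorem hornerR_prepGo {C D : ℕ} {cs : List ℤ} (hC : ∀ c ∈ cs, 0 ≤ c + C) (hlen : cs.length = D + 1) (m : ℕ) :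
    ((hornerR m (prepGo C D 0 cs) : ℕ) : ℤ) = ∑ k ∈ range (D + 1), (cs.getD k 0 + C) * (m : ℤ) ^ k * (MR : ℤ) ^ (D - k) := by
  rw [hornerR_eq_sum, length_prepGo, hlen, Nat.cast_sum]
  refine Finset.sum_congr rfl fun k hk => ?_
  rw [Finset.mem_range] at hk
  rw [getD_prepGo C D 0 cs k (by omega), Nat.zero_add]
  have hnn : 0 ≤ cs.getD k 0 + C := by
    have hmem : cs.getD k 0 ∈ cs := by
      rw [List.getD_eq_getElem _ _ (by omega)]; exact List.getElem_mem _
    exact hC _ hmem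
  have hMR : ((MR : ℕ) : ℤ) ^ (D - k) = 2 ^ (RB * (D - k)) := by
    rw [pow_mul]; norm_num [MR, RB]
  push_cast
  rw [Int.toNat_of_nonneg hnn, hMR]
  ring

/-- The geometric identity `(M − m)·Σ_{k≤D} m^k M^{D−k} = M^{D+1} − m^{D+1}` in `ℤ`. -/
theorem geom_identity (M m : ℤ) (D : ℕ) : (M - m) * ∑ k ∈ range (D + 1), m ^ k * M ^ (D - k) = M ^ (D + 1) - m ^ (D + 1) := by
  have h := (Commute.all m M).geom_sum₂_mul (D + 1)
  -- `(∑ i in range n, m ^ i * M ^ (n - 1 - i)) * (m - M) = m ^ n - M ^ n`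
  have h2 : ∑ k ∈ range (D + 1), m ^ k * M ^ (D - k) = ∑ i ∈ range (D + 1), m ^ i * M ^ (D + 1 - 1 - i) := by
    refine Finset.sum_congr rfl fun i _ => ?_
    rw [show D + 1 - 1 - i = D - i by omega]
  rw [h2]
  linear_combination (-1 : ℤ) * h

/-- **`geoSum`** is the geometric sum `Σ_{k≤D} m^k M^{D−k}` for `m < M`. -/
theorem geoSum_eq {D m : ℕ} (hm : m < MR) : (geoSum D m : ℤ) = ∑ k ∈ range (D + 1), (m : ℤ) ^ k * (MR : ℤ) ^ (D - k) := by
  unfold geoSum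
  have hpos : 0 < MR - m := Nat.sub_pos_of_lt hm
  have hle : m ^ (D + 1) ≤ MR ^ (D + 1) := Nat.pow_le_pow_left hm.le _
  have hid := geom_identity (MR : ℤ) (m : ℤ) D
  have hnn : 0 ≤ ∑ k ∈ range (D + 1), (m : ℤ) ^ k * (MR : ℤ) ^ (D - k) :=
    Finset.sum_nonneg fun k _ => by positivity
  obtain ⟨S, hS⟩ : ∃ S : ℕ, (S : ℤ) = ∑ k ∈ range (D + 1), (m : ℤ) ^ k * (MR : ℤ) ^ (D - k) :=
    ⟨(∑ k ∈ range (D + 1), (m : ℤ) ^ k * (MR : ℤ) ^ (D - k)).toNat, Int.toNat_of_nonneg hnn⟩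
  have hdiv : MR ^ (D + 1) - m ^ (D + 1) = (MR - m) * S := by
    have : ((MR ^ (D + 1) - m ^ (D + 1) : ℕ) : ℤ) = ((MR - m : ℕ) : ℤ) * S := by
      push_cast [Nat.cast_sub hle, Nat.cast_sub hm.le]
      rw [hS, hid]
    exact_mod_cast this
  rw [hdiv, Nat.mul_div_cancel_left _ hpos, hS]

/-- **The Horner value is the polynomial value**: `hornerR m c − C·geoSum = M^D · H(m/M)` (over `ℝ`). -/
theorem horner_value {C D : ℕ} {cs : List ℤ} (hC : ∀ c ∈ cs, 0 ≤ c + C) (hlen : cs.length = D + 1) {m : ℕ}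
    (hm : m < MR) :
    ((hornerR m (prepGo C D 0 cs) : ℕ) : ℝ) - (C : ℝ) * (geoSum D m : ℕ) = (MR : ℝ) ^ D * evalZ cs ((m : ℝ) / MR) := by
  have h1 := congrArg (Int.cast : ℤ → ℝ) (hornerR_prepGo hC hlen m)
  have h2 := congrArg (Int.cast : ℤ → ℝ) (geoSum_eq (D := D) hm)
  push_cast at h1 h2
  rw [h1, h2, evalZ_eq_sum, hlen, Finset.mul_sum, Finset.mul_sum, ← Finset.sum_sub_distrib]
  refine Finset.sum_congr rfl fun k hk => ?_
  rw [Finset.mem_range] at hk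
  have hM : (MR : ℝ) ≠ 0 := by norm_num [MR]
  have hsplit : (MR : ℝ) ^ D = (MR : ℝ) ^ k * (MR : ℝ) ^ (D - k) := by rw [← pow_add]; congr 1; omega
  rw [div_pow, hsplit]
  field_simp
  ring

end Summit.RiemannHypothesis.RiemannHypothesis.Theorems.IntegerScrew.Manifest.Fast
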